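import Mathlib
import Summits.NavierStokesRegularity.NavierStokesRegularity.Theorems.FilamentSkeletonRssStadiumKernelPieces

/-!
# Route `FilamentSkeletonRss` · child crux `TangentSkeletonNearStraightL` (stmt-NavierStokesRegularity-23320) · registered line
# `child_tangent_analytic_strip_L` (b0b56c52900dd90a), stub `stub_stripPropagation` — bricks: CAUCHY ESTIMATE FOR `F″` AND THE NUMERATOR
# CANCELLATION ON THE SHIFTED SEGMENT (R5/R6 of the STUB-PLAN memo attached to 23320)

* `norm_deriv_deriv_le_of_closedBall` — if `F : ℂ → ℂ³` is complex-differentiable on an open `U` with `‖F′‖ ≤ B` on `U` and the closed disc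
  `closedBall c R ⊆ U` (`R > 0`), then `‖F″(c)‖ ≤ B/R` (Cauchy estimate applied to `F′`; in the stub `B = 2`, `R = hs/2` on the half stadium);
* `norm_cross_chord_le` — the numerator of the matched kernel on the shifted segment cancels to second order: with `Σ`-free bilinear cross
  product `⨯₃` on `ℂ³`, `‖F′(z+s)‖ ≤ B₁` and the tangent Lipschitz bound `‖F′(z+r) − F′(z+s)‖ ≤ K₂·|r − s|` along the horizontal segment,
  `‖F′(z+s) ⨯₃ (F(z) − F(z+s))‖ ≤ 2·B₁·K₂·s²` (because `F(z) − F(z+s) = −∫₀ˢ F′(z+r) dr` and `u ⨯₃ u = 0`).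
HONEST FRAMING: bricks for a plan about a HYPOTHETICAL filament skeleton on the NEGATIVE side of a MODEL route; the stub `stub_stripPropagation` is
NOT closed; nothing here bears on Navier–Stokes regularity or blow-up.  `--supports stmt-NavierStokesRegularity-23320`.
-/

set_option linter.dupNamespace false

noncomputable section

namespace Summit.NavierStokesRegularity.NavierStokesRegularity.Theorems.StadiumCauchyNumerator

open Set Filter Topology Complex Metric
open scoped Matrix

/-- **Cauchy estimate for the second derivative.**  `F : ℂ → ℂ³` complex-differentiable on an open `U`, `‖F′‖ ≤ B` on `U`,
`closedBall c R ⊆ U`, `0 < R`: then `‖F″(c)‖ ≤ B / R`. [folklore] -/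
theorem norm_deriv_deriv_le_of_closedBall {U : Set ℂ} (hU : IsOpen U) {F : ℂ → (Fin 3 → ℂ)} (hF : DifferentiableOn ℂ F U)
    {B : ℝ} (hB : ∀ z ∈ U, ‖deriv F z‖ ≤ B) {c : ℂ} {R : ℝ} (hR : 0 < R) (hsub : closedBall c R ⊆ U) :
    ‖deriv (deriv F) c‖ ≤ B / R := by
  have hdF : DifferentiableOn ℂ (deriv F) U := ((hF.analyticOnNhd hU).deriv).differentiableOn
  have hd : DiffContOnCl ℂ (deriv F) (ball c R) := by
    refine DifferentiableOn.diffContOnCl ?_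
    rw [closure_ball c hR.ne']
    exact hdF.mono hsub
  exact Complex.norm_deriv_le_of_forall_mem_sphere_norm_le hR hd fun z hz => hB z (hsub (sphere_subset_closedBall hz))

/-- **Numerator cancellation on the shifted segment.**  `F : ℂ → ℂ³` complex-differentiable on an open `U` containing the horizontal segment
`{z + r : r between 0 and s}`; if `‖F′(z+s)‖ ≤ B₁` and `‖F′(z+r) − F′(z+s)‖ ≤ K₂·|r − s|` (`K₂ ≥ 0`) along the segment, then
`‖F′(z+s) ⨯₃ (F(z) − F(z+s))‖ ≤ 2·B₁·K₂·s²`. [folklore] -/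
theorem norm_cross_chord_le {U : Set ℂ} (hU : IsOpen U) {F : ℂ → (Fin 3 → ℂ)} (hF : DifferentiableOn ℂ F U)
    {z : ℂ} {s B₁ K₂ : ℝ} (hseg : ∀ r ∈ Set.uIcc 0 s, z + (r : ℂ) ∈ U)
    (hB₁ : ‖deriv F (z + (s : ℂ))‖ ≤ B₁) (hK0 : 0 ≤ K₂)
    (hK₂ : ∀ r ∈ Set.uIcc 0 s, ‖deriv F (z + (r : ℂ)) - deriv F (z + (s : ℂ))‖ ≤ K₂ * |r - s|) :
    ‖deriv F (z + (s : ℂ)) ⨯₃ (F z - F (z + (s : ℂ)))‖ ≤ 2 * B₁ * K₂ * s ^ 2 := by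
  set u : Fin 3 → ℂ := deriv F (z + (s : ℂ)) with hu
  set a : ℝ → (Fin 3 → ℂ) := fun r => deriv F (z + (r : ℂ)) with ha
  -- continuity of `a` on the segment
  have hdcont : ContinuousOn (deriv F) U := ((hF.analyticOnNhd hU).deriv).continuousOn
  have hpath_cont : Continuous fun r : ℝ => z + (r : ℂ) := continuous_const.add Complex.continuous_ofReal
  have ha_cont : ContinuousOn a (uIcc 0 s) := hdcont.comp hpath_cont.continuousOn fun r hr => hseg r hr
  -- `F(z+s) − F(z) = ∫₀ˢ a`
  have hderiv : ∀ r ∈ uIcc 0 s, HasDerivAt (fun r : ℝ => F (z + (r : ℂ))) (a r) r := by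
    intro r hr
    have hFd : HasDerivAt F (deriv F (z + (r : ℂ))) (z + (r : ℂ)) :=
      (hF.differentiableAt (hU.mem_nhds (hseg r hr))).hasDerivAt
    have hp : HasDerivAt (fun r : ℝ => z + (r : ℂ)) ((1 : ℝ) : ℂ) r := ((hasDerivAt_id r).ofReal_comp).const_add z
    have h := hFd.scomp r hp
    rw [Complex.ofReal_one, one_smul] at h
    exact h
  have hint : IntervalIntegrable a MeasureTheory.volume 0 s := ha_cont.intervalIntegrable
  have hFTC : F (z + (s : ℂ)) - F z = ∫ r in (0:ℝ)..s, a r := by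
    rw [intervalIntegral.integral_eq_sub_of_hasDerivAt hderiv hint]
    simp
  -- the cross product with `u` as a continuous linear map, pushed through the integral
  set Cu : (Fin 3 → ℂ) →L[ℂ] (Fin 3 → ℂ) := LinearMap.toContinuousLinearMap (crossProduct u) with hCu
  have hCu_apply : ∀ v, Cu v = u ⨯₃ v := fun v => rfl
  have h1 : u ⨯₃ (F z - F (z + (s : ℂ))) = -(∫ r in (0:ℝ)..s, u ⨯₃ (a r - u)) := by
    have e1 : F z - F (z + (s : ℂ)) = -(∫ r in (0:ℝ)..s, a r) := by rw [← hFTC]; abel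
    have hCa : IntervalIntegrable (fun r => Cu (a r)) MeasureTheory.volume 0 s :=
      (Cu.continuous.comp_continuousOn ha_cont).intervalIntegrable
    have e2 : ∫ r in (0:ℝ)..s, u ⨯₃ (a r - u) = ∫ r in (0:ℝ)..s, (Cu (a r) - Cu u) := by
      refine intervalIntegral.integral_congr fun r _ => ?_
      simp only [hCu_apply, ← map_sub]
    rw [e1, ← hCu_apply, map_neg, ← ContinuousLinearMap.intervalIntegral_comp_comm Cu hint, e2,
      intervalIntegral.integral_sub hCa intervalIntegrable_const, intervalIntegral.integral_const]
    simp [hCu_apply, cross_self]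
  -- bound
  have hB0 : 0 ≤ B₁ := (norm_nonneg _).trans hB₁
  have hb : ∀ r ∈ Set.uIoc (0:ℝ) s, ‖u ⨯₃ (a r - u)‖ ≤ 2 * B₁ * (K₂ * |s|) := by
    intro r hr
    have hr' : r ∈ uIcc 0 s := uIoc_subset_uIcc hr
    have hrs : |r - s| ≤ |s| := by
      rw [abs_sub_comm]; simpa using Set.abs_sub_right_of_mem_uIcc hr'
    calc ‖u ⨯₃ (a r - u)‖ ≤ 2 * ‖u‖ * ‖a r - u‖ :=
          Summit.NavierStokesRegularity.NavierStokesRegularity.Theorems.StadiumKernelPieces.norm_crossProduct_le _ _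
      _ ≤ 2 * B₁ * (K₂ * |r - s|) :=
          mul_le_mul (mul_le_mul_of_nonneg_left hB₁ (by norm_num)) (hK₂ r hr') (norm_nonneg _) (by positivity)
      _ ≤ 2 * B₁ * (K₂ * |s|) :=
          mul_le_mul_of_nonneg_left (mul_le_mul_of_nonneg_left hrs hK0) (by positivity)
  rw [h1, norm_neg]
  have h := intervalIntegral.norm_integral_le_of_norm_le_const hb
  calc ‖∫ r in (0:ℝ)..s, u ⨯₃ (a r - u)‖ ≤ 2 * B₁ * (K₂ * |s|) * |s - 0| := h
    _ = 2 * B₁ * K₂ * (|s| * |s|) := by rw [sub_zero]; ring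
    _ = 2 * B₁ * K₂ * s ^ 2 := by rw [abs_mul_abs_self]; ring

end Summit.NavierStokesRegularity.NavierStokesRegularity.Theorems.StadiumCauchyNumerator

end
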